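import Summits.HodgeConjecture.CorCM.Census.QuaternionColumnIndep

/-!
# The quaternion column at EVEN level, II: the characters and the fibre factorisation of `thetaVec` for every even `n`

COR-CM (cell `pub-hodgecm2`), count-neutral kernel combinatorics by the binder seat b09 (gen 40; lane RELATIVE SPLITTING, part VI = gen 39ʼs
QUATERNION COLUMN at even level), on `Census/QuaternionColumn{Characters,Indep,Pivot}.lean` (gen 39) and `Census/QuaternionColumnEven.lean`
(gen 40), all BY NAME.  Theorems only: no definition, no `decide` beyond gen 39ʼs closed `ZMod 2` identities, no certificate, no named fact, no `sorry`.
HONEST FRAMING: `HC_CM` is NOT proved, here or anywhere in the tree; nothing here is a period or a headline.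

WHY.  Gen 39 proved the fibre-independence of `qfam n` (`qfam_fibreIndep`) under `n = 2^m`; the hypothesis entered at ONE place: an odd rotation
`a i` fixes no CM type because some power of it is `c = a n` (`rt_a_odd_ne`, proved with `i` a unit of `ℤ/2^{m+1}`).  But `t·i ≡ n (mod 2n)` is
solvable for EVERY `n` and odd `i` (Bézout: `gcd(i, 2n)` is odd, hence divides `n`), so the whole chain `chiB_stab → theta_table → thetaVec_eq_comp →
fibreIndep_of_thetaVec → thetaVec_faceI_indep → qfam_fibreIndep` holds for every EVEN `n ≥ 4` (evenness is what the character `χ_b` and the parity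
cycles use).  This file re-runs the first half of the chain with that one lemma replaced (primed names `rt_a_odd_ne'`, `chiB_stab'`, `theta_table'`,
`thetaVec_eq_comp'`, `fibreIndep_of_thetaVec'`; the proofs are gen 39ʼs with the hypothesis lines changed); the pivot argument and the law at even
level follow in `Census/QuaternionColumnEvenPivot.lean`.

## References
* [Pohlmann1968] H. Pohlmann, Algebraic cycles on abelian varieties of complex multiplication type, Ann. of Math. 88 (1968), Thm 1.
* [Milne1999] J. S. Milne, Lefschetz motives and the Tate conjecture, Compositio Math. 117 (1999), Prop. 2.1, p. 54.
-/

namespace Summit.HodgeConjecture.CorCM.Census.QuaternionColumn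

open Finset QuaternionGroup
open Summit.HodgeConjecture.CorCM.Prior.AllgGroup.RfwfAllgGroup
open Summit.HodgeConjecture.CorCM.Census.BlockParity
open Summit.HodgeConjecture.CorCM.Census.Coinvariant
open Summit.HodgeConjecture.CorCM.Census.HalfParity
open Summit.HodgeConjecture.CorCM.Census.Splitting
open Summit.HodgeConjecture.CorCM.Census.BaseBlock
open Summit.HodgeConjecture.CorCM.Census.TwistGeneration

noncomputable section

variable {n : ℕ} [NeZero n]

/-! ## §1 An odd rotation fixes no type — for every `n` -/

/-- **An odd rotation fixes no type**, for EVERY `n`: if `i` is odd then `t·i ≡ n (mod 2n)` is solvable (`gcd(i,2n)` is odd, so divides `n`), hence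
some power of `a i` is `c = a n`, which fixes no type. [folklore] -/
theorem rt_a_odd_ne' (i : ZMod (2 * n)) (hi : Odd i.val) (Ψ : CMF (QuaternionGroup n) (c n)) : rt (c n) (a i) Ψ ≠ Ψ := by
  intro h
  have hn := NeZero.ne n
  -- Bézout: `t * i = n` in `ℤ/2n`
  obtain ⟨t, ht⟩ : ∃ t : ZMod (2 * n), t * i = (n : ZMod (2 * n)) := by
    set g := Nat.gcd i.val (2 * n) with hg
    have hgodd : Odd g := hi.of_dvd_nat (Nat.gcd_dvd_left _ _)
    have hg2n : g ∣ n * 2 := by rw [mul_comm]; exact Nat.gcd_dvd_right _ _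
    have hgn : g ∣ n := (Nat.coprime_two_right.mpr hgodd).dvd_of_dvd_mul_right hg2n
    have hbez : ((g : ℤ) : ZMod (2 * n)) = ((i.val : ℤ) : ZMod (2 * n)) * ((Nat.gcdA i.val (2 * n) : ℤ) : ZMod (2 * n)) := by
      have e := Nat.gcd_eq_gcd_ab i.val (2 * n)
      rw [← hg] at e
      have h0 : (((2 * n : ℕ) : ℤ) : ZMod (2 * n)) = 0 := by rw [Int.cast_natCast, ZMod.natCast_self]
      apply_fun (fun z : ℤ => (z : ZMod (2 * n))) at e
      rw [Int.cast_add, Int.cast_mul, Int.cast_mul, h0, zero_mul, add_zero] at e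
      exact e
    refine ⟨((n / g : ℕ) : ZMod (2 * n)) * ((Nat.gcdA i.val (2 * n) : ℤ) : ZMod (2 * n)), ?_⟩
    rw [Int.cast_natCast, Int.cast_natCast, ZMod.natCast_zmod_val] at hbez
    rw [mul_assoc, mul_comm _ i, ← hbez, ← Nat.cast_mul, Nat.div_mul_cancel hgn]
  have hpow : (a i : QuaternionGroup n) ^ t.val = c n := by
    rw [a_pow, ZMod.natCast_zmod_val, ht]; rfl
  have h2 := rt_pow_eq_self h t.val
  rw [hpow] at h2
  exact rt_c_ne Ψ h2

/-- **`χ_b` kills every type stabiliser**, for every `n`. [folklore] -/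
theorem chiB_stab' (Ψ : CMF (QuaternionGroup n) (c n)) (Q : QuaternionGroup n) (h : rt (c n) Q Ψ = Ψ) : chiB Q = 0 := by
  cases Q with
  | a i =>
    by_contra hne
    have h1 : chiB (a i : QuaternionGroup n) = 1 := by
      have key : ∀ x : ZMod 2, x ≠ 0 → x = 1 := by decide
      exact key _ hne
    exact rt_a_odd_ne' i ((castHom_eq_one_iff i).mp h1) Ψ h
  | xa k => exact absurd h (rt_xa_ne k Ψ)

/-- **THE TABLE** `(θ_{χ_a}, θ_{χ_b})` of the even cycle is `(1, 1)`, of the odd cycle `(1, 0)` — for every EVEN `n`. [folklore] -/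
theorem theta_table' (heven : Even n) :
    theta (c n) chiA (red (c n) (∑ t ∈ range (n / 2), fplus (((2 * t + 0 : ℕ) : ℕ) : ZMod (2 * n)) 0)) = 1 ∧
      theta (c n) chiB (red (c n) (∑ t ∈ range (n / 2), fplus (((2 * t + 0 : ℕ) : ℕ) : ZMod (2 * n)) 0)) = 1 ∧
        theta (c n) chiA (red (c n) (∑ t ∈ range (n / 2), fplus (((2 * t + 1 : ℕ) : ℕ) : ZMod (2 * n)) 0)) = 1 ∧
          theta (c n) chiB (red (c n) (∑ t ∈ range (n / 2), fplus (((2 * t + 1 : ℕ) : ℕ) : ZMod (2 * n)) 0)) = 0 := by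
  refine ⟨?_, ?_, ?_, ?_⟩
  · rw [theta_cycle chiA_mul chiA_stab heven 0]; rfl
  · rw [theta_cycle (chiB_mul heven) chiB_stab' heven 0, Nat.cast_zero, zero_sub]
    show ZMod.castHom (dvd_mul_right 2 n) (ZMod 2) (-1 : ZMod (2 * n)) = 1
    rw [map_neg, map_one]; decide
  · rw [theta_cycle chiA_mul chiA_stab heven 1]; rfl
  · rw [theta_cycle (chiB_mul heven) chiB_stab' heven 1, Nat.cast_one, sub_self]
    show ZMod.castHom (dvd_mul_right 2 n) (ZMod 2) (0 : ZMod (2 * n)) = 0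
    rw [map_zero]

/-! ## §2 `thetaVec` factors through the fibre — for every even `n` -/

/-- **`thetaVec` factors through the fibre** (every EVEN `n`). [folklore] -/
theorem thetaVec_eq_comp' (heven : Even n) :
    ∃ L : ((CMF (QuaternionGroup n) (c n) →₀ ZMod 2) ⧸ rad2 (c n) c_mul_c) →ₗ[ZMod 2] (Block (c n) ⊕ Bool → ZMod 2),
      ∀ f, thetaVec f = L ((rad2 (c n) c_mul_c).mkQ (red (c n) f)) := by
  let T : (CMF (QuaternionGroup n) (c n) →₀ ZMod 2) →ₗ[ZMod 2] (Block (c n) ⊕ Bool → ZMod 2) :=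
    { toFun := fun v x => match x with
        | Sum.inl B => par2 (c n) v B
        | Sum.inr false => theta (c n) chiA v
        | Sum.inr true => theta (c n) chiB v
      map_add' := fun v w => by funext x; rcases x with B | (_ | _) <;> simp only [map_add, Pi.add_apply]
      map_smul' := fun r v => by funext x; rcases x with B | (_ | _) <;> simp only [map_smul, Pi.smul_apply, RingHom.id_apply] }
  have hker : rad2 (c n) c_mul_c ≤ LinearMap.ker T := by
    intro v hv
    rw [LinearMap.mem_ker]
    funext x
    rcases x with B | (_ | _)
    · exact congrFun (LinearMap.mem_ker.mp (rad2_le_ker_par2 (c n) c_mul_c hv)) B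
    · exact LinearMap.mem_ker.mp (rad2_le_ker_theta (c n) chiA_mul chiA_stab c_mul_c c_comm chiA_c hv)
    · exact LinearMap.mem_ker.mp (rad2_le_ker_theta (c n) (chiB_mul heven) chiB_stab' c_mul_c c_comm (chiB_c heven) hv)
  refine ⟨(rad2 (c n) c_mul_c).liftQ T hker, fun f => ?_⟩
  rw [Submodule.mkQ_apply, Submodule.liftQ_apply]
  funext x
  rcases x with B | (_ | _)
  · show par (c n) f B = par2 (c n) (red (c n) f) B; rw [par2_red]
  · rfl
  · rfl

/-- **Independence of the functional vectors implies fibre-independence** (every EVEN `n`). [folklore] -/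
theorem fibreIndep_of_thetaVec' (heven : Even n) (s : Set (CMF (QuaternionGroup n) (c n) →₀ ℤ))
    (h : LinearIndepOn (ZMod 2) (fun f => thetaVec f) s) :
    LinearIndepOn (ZMod 2) (fun f : CMF (QuaternionGroup n) (c n) →₀ ℤ => (rad2 (c n) c_mul_c).mkQ (red (c n) f)) s := by
  obtain ⟨L, hL⟩ := thetaVec_eq_comp' (n := n) heven
  have e : (fun f : CMF (QuaternionGroup n) (c n) →₀ ℤ => thetaVec f) = L ∘ (fun f => (rad2 (c n) c_mul_c).mkQ (red (c n) f)) := by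
    funext f; exact hL f
  rw [e] at h
  exact LinearIndepOn.of_comp L h

end

end Summit.HodgeConjecture.CorCM.Census.QuaternionColumn
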